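import Summits.CriticalPhenomena.PercolationContinuityZ3.Theorems.PercNearOneGluingNoHeavyQuantPeierlsStarGeometry
import HarnessLib

/-!
# QUANT lane / PAPER-2 rate track (ARM-2, gen 6), Peierls lever P1‴a: crossing parity of closed `★`-walks on `ℤ²`

builds on p205010 (kernel theorem, internal audit signed; external expert review pending)

Cell `prim-quant`, seat `prim-quant-arm-2` (constants bookkeeper; `quant/prim-quant-arm-2-g6/STATUS.md`, RATE-CONSTANTS.md §2h).  The
`★`-ANIMAL Peierls lever of the explicit one-arm rate ends at the driver threshold `2⁻⁵` (arm-2 g5, `StarPeierls.one_lt_peierls_four_partial`).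
The next rung `2⁻⁴` needs `★`-CIRCUITS of blocked macro-vertices (entropy `≤ 10` per vertex against `ε` per vertex) instead of animals.
The architect priced this at a planar-topology file ("the exterior boundary of a finite cluster is a `★`-circuit", RATE-PLAN §13.2).  This
file and `…QuantStarContour` replace the topology by an `𝔽₂` argument in the style of the tree's `Literature/…/DualContours.lean`:
here, the purely one-dimensional calculus of CLOSED `★`-WALKS `y : ℕ → ℤ²` (periodic, consecutive points at sup-distance `≤ 1`):

* `cf u v` — the crossing indicator of a step: one endpoint on row `0` at abscissa `≥ 1`, the other on row `1` (a crossing of the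
  horizontal line at height `¼` to the right of `(½, ¼)`); `cpar n y = Σ_{m<n} cf (y m) (y (m+1))` its parity over a period;
* `cpar` is invariant under rotation (`cpar_shift`) and ADDITIVE under splitting a closed walk at a repeated point (`cpar_split`), hence
  (`exists_injOn_cycWalk`) a closed walk of odd parity contains a SELF-AVOIDING closed walk of odd parity (on a subset of its points);
* the number of steps between rows `0` and `1` of a closed walk is even (telescoping), so odd parity forces a point `(a, 0)` with `a ≥ 1`
  AND a point `(a', 0)` with `a' ≤ -1` when the walk avoids the origin (`exists_posAxis`, `exists_negAxis`), and `|a − a'|` is at most the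
  index distance (`CycWalk.abs_sub_le`): the anchor of the Peierls count.

No percolation here; consumed by `…QuantStarContour` (the contour) and `…QuantPeierlsStarDriverFour` (the driver at `2⁻⁴`).
[cite: GrimmettPercolation1999, §1.4 pp. 15–18 (Peierls' argument)] [cite: Kesten1982, §2.2 p. 386 (circuits surrounding a finite cluster)]
-/

noncomputable section

namespace Summit.CriticalPhenomena.PercolationContinuityZ3.Theorems.Quant.StarContour

open Literature.Probability.LatticeModels Literature.Probability.Percolation Finset
open Literature.Probability.Percolation.Contour (site_ext sum_range_telescope zmod2_add_self zmod2_eq_zero_or_one)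
open Summit.CriticalPhenomena.PercolationContinuityZ3.Theorems.Quant.StarPeierls (supDist_le_one_iff)

/-! ## Step indicators in `ZMod 2` -/

/-- Crossing indicator of the step `{u, v}` to the RIGHT: one endpoint on row `0` at abscissa `≥ 1`, the other on row `1`.
builds on p205010 (kernel theorem, internal audit signed; external expert review pending). [folklore] -/
def cf (u v : Site 2) : ZMod 2 :=
  if (u 1 = 0 ∧ 1 ≤ u 0 ∧ v 1 = 1) ∨ (v 1 = 0 ∧ 1 ≤ v 0 ∧ u 1 = 1) then 1 else 0

/-- Crossing indicator of the step `{u, v}` to the LEFT: one endpoint on row `0` at abscissa `≤ 0`, the other on row `1`.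
builds on p205010 (kernel theorem, internal audit signed; external expert review pending). [folklore] -/
def cf' (u v : Site 2) : ZMod 2 :=
  if (u 1 = 0 ∧ u 0 ≤ 0 ∧ v 1 = 1) ∨ (v 1 = 0 ∧ v 0 ≤ 0 ∧ u 1 = 1) then 1 else 0

/-- Row-step indicator: the step `{u, v}` joins row `0` to row `1`.
builds on p205010 (kernel theorem, internal audit signed; external expert review pending). [folklore] -/
def rs (u v : Site 2) : ZMod 2 := if (u 1 = 0 ∧ v 1 = 1) ∨ (v 1 = 0 ∧ u 1 = 1) then 1 else 0

/-- Upper half-plane indicator (`row ≥ 1`).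
builds on p205010 (kernel theorem, internal audit signed; external expert review pending). [folklore] -/
def uh (u : Site 2) : ZMod 2 := if 1 ≤ u 1 then 1 else 0

/-- `cf` is symmetric.
builds on p205010 (kernel theorem, internal audit signed; external expert review pending). [folklore] -/
theorem cf_comm (u v : Site 2) : cf u v = cf v u := by
  unfold cf
  by_cases h1 : (u 1 = 0 ∧ 1 ≤ u 0 ∧ v 1 = 1) <;> by_cases h2 : (v 1 = 0 ∧ 1 ≤ v 0 ∧ u 1 = 1) <;> simp [h1, h2]

/-- A row step crosses either to the right or to the left.
builds on p205010 (kernel theorem, internal audit signed; external expert review pending). [folklore] -/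
theorem rs_eq_cf_add_cf' (u v : Site 2) : rs u v = cf u v + cf' u v := by
  unfold rs cf cf'
  by_cases h1 : (u 1 = 0 ∧ 1 ≤ u 0 ∧ v 1 = 1) ∨ (v 1 = 0 ∧ 1 ≤ v 0 ∧ u 1 = 1) <;>
    by_cases h2 : (u 1 = 0 ∧ u 0 ≤ 0 ∧ v 1 = 1) ∨ (v 1 = 0 ∧ v 0 ≤ 0 ∧ u 1 = 1) <;>
    by_cases h3 : (u 1 = 0 ∧ v 1 = 1) ∨ (v 1 = 0 ∧ u 1 = 1) <;>
    simp only [h1, h2, h3, if_true, if_false] <;> first | decide | (exfalso; omega)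

/-- Along a `★`-step, a row step is exactly a change of the upper half-plane indicator.
builds on p205010 (kernel theorem, internal audit signed; external expert review pending). [folklore] -/
theorem rs_eq_uh_add_uh {u v : Site 2} (h : supDist u v ≤ 1) : rs u v = uh u + uh v := by
  rw [supDist_le_one_iff] at h
  obtain ⟨-, h1⟩ := h
  unfold rs uh
  by_cases h2 : 1 ≤ u 1 <;> by_cases h3 : 1 ≤ v 1 <;>
    by_cases h4 : (u 1 = 0 ∧ v 1 = 1) ∨ (v 1 = 0 ∧ u 1 = 1) <;>
    simp only [h2, h3, h4, if_true, if_false] <;> first | decide | (exfalso; omega)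

/-! ## Closed `★`-walks as periodic sequences -/

/-- A CLOSED `★`-WALK of period `n ≥ 1`: an `n`-periodic sequence of sites, consecutive ones at sup-distance `≤ 1` (lazy steps allowed).
builds on p205010 (kernel theorem, internal audit signed; external expert review pending). [folklore] -/
def CycWalk (n : ℕ) (y : ℕ → Site 2) : Prop :=
  0 < n ∧ (∀ m, y (m + n) = y m) ∧ ∀ m, supDist (y m) (y (m + 1)) ≤ 1

/-- The crossing parity of a closed walk over one period.
builds on p205010 (kernel theorem, internal audit signed; external expert review pending). [folklore] -/
def cpar (n : ℕ) (y : ℕ → Site 2) : ZMod 2 := ∑ m ∈ Finset.range n, cf (y m) (y (m + 1))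

namespace CycWalk

variable {n : ℕ} {y : ℕ → Site 2}

/-- A closed walk has positive period.
builds on p205010 (kernel theorem, internal audit signed; external expert review pending). [folklore] -/
theorem pos (h : CycWalk n y) : 0 < n := h.1

/-- A closed walk is periodic.
builds on p205010 (kernel theorem, internal audit signed; external expert review pending). [folklore] -/
theorem per (h : CycWalk n y) (m : ℕ) : y (m + n) = y m := h.2.1 m

/-- Consecutive points of a closed walk are at sup-distance at most one.
builds on p205010 (kernel theorem, internal audit signed; external expert review pending). [folklore] -/
theorem step (h : CycWalk n y) (m : ℕ) : supDist (y m) (y (m + 1)) ≤ 1 := h.2.2 m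

/-- Periodicity over several periods.
builds on p205010 (kernel theorem, internal audit signed; external expert review pending). [folklore] -/
theorem apply_add_mul (h : CycWalk n y) (m k : ℕ) : y (m + n * k) = y m := by
  induction k with
  | zero => simp
  | succ k ih => rw [Nat.mul_succ, ← add_assoc, h.per, ih]

/-- Values only depend on the index modulo the period.
builds on p205010 (kernel theorem, internal audit signed; external expert review pending). [folklore] -/
theorem apply_eq_apply_mod (h : CycWalk n y) (m : ℕ) : y m = y (m % n) := by
  conv_lhs => rw [← Nat.mod_add_div m n]
  exact h.apply_add_mul _ _

/-- The walk closes up after one period.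
builds on p205010 (kernel theorem, internal audit signed; external expert review pending). [folklore] -/
theorem apply_period (h : CycWalk n y) : y n = y 0 := by
  simpa using h.per 0

/-- Rotating a closed walk gives a closed walk.
builds on p205010 (kernel theorem, internal audit signed; external expert review pending). [folklore] -/
theorem shift (h : CycWalk n y) (i : ℕ) : CycWalk n (fun m => y (m + i)) := by
  refine ⟨h.pos, fun m => ?_, fun m => ?_⟩
  · show y (m + n + i) = y (m + i)
    rw [Nat.add_right_comm m n i, h.per]
  · show supDist (y (m + i)) (y (m + 1 + i)) ≤ 1
    rw [Nat.add_right_comm m 1 i]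
    exact h.step (m + i)

/-- Rotation preserves injectivity on a period.
builds on p205010 (kernel theorem, internal audit signed; external expert review pending). [folklore] -/
theorem injOn_shift (h : CycWalk n y) (hinj : Set.InjOn y (Set.Iio n)) (i : ℕ) :
    Set.InjOn (fun m => y (m + i)) (Set.Iio n) := by
  intro m hm l hl hml
  simp only at hml
  rw [h.apply_eq_apply_mod (m + i), h.apply_eq_apply_mod (l + i)] at hml
  have hmod : (m + i) % n = (l + i) % n :=
    hinj (Nat.mod_lt _ h.pos) (Nat.mod_lt _ h.pos) hml
  have hme : m ≡ l [MOD n] := Nat.ModEq.add_right_cancel' i hmod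
  exact Nat.ModEq.eq_of_lt_of_lt hme hm hl

/-- Along a closed `★`-walk the abscissa moves by at most one per step.
builds on p205010 (kernel theorem, internal audit signed; external expert review pending). [folklore] -/
theorem abs_sub_le (h : CycWalk n y) {m l : ℕ} (hml : m ≤ l) : |y l 0 - y m 0| ≤ (l : ℤ) - m := by
  induction l, hml using Nat.le_induction with
  | base => simp
  | succ l hml ih =>
    have h2 : |y (l + 1) 0 - y l 0| ≤ 1 := by
      have := (supDist_le_one_iff.1 (h.step l)).1
      rw [abs_sub_comm]
      have hle : |y l 0 - y (l + 1) 0| = ((y l 0 - y (l + 1) 0).natAbs : ℤ) := (Int.natCast_natAbs _).symm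
      rw [hle]; exact_mod_cast this
    calc |y (l + 1) 0 - y m 0| = |(y (l + 1) 0 - y l 0) + (y l 0 - y m 0)| := by ring_nf
      _ ≤ |y (l + 1) 0 - y l 0| + |y l 0 - y m 0| := abs_add_le _ _
      _ ≤ 1 + ((l : ℤ) - m) := add_le_add h2 ih
      _ = ((l + 1 : ℕ) : ℤ) - m := by push_cast; ring

end CycWalk

/-! ## Rotation invariance of the parity -/

/-- A cyclic sum is invariant under shifting the index by one.
builds on p205010 (kernel theorem, internal audit signed; external expert review pending). [folklore] -/
theorem sum_range_succ_shift {F : ℕ → ZMod 2} {n : ℕ} (hF : F n = F 0) :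
    ∑ m ∈ Finset.range n, F (m + 1) = ∑ m ∈ Finset.range n, F m := by
  have h1 := Finset.sum_range_succ' F n
  have h2 := Finset.sum_range_succ F n
  rw [h2, hF] at h1
  exact (add_right_cancel h1).symm

/-- A cyclic sum of a periodic function is invariant under rotation.
builds on p205010 (kernel theorem, internal audit signed; external expert review pending). [folklore] -/
theorem sum_range_shift_periodic {F : ℕ → ZMod 2} {n : ℕ} (hF : ∀ m, F (m + n) = F m) (i : ℕ) :
    ∑ m ∈ Finset.range n, F (m + i) = ∑ m ∈ Finset.range n, F m := by
  induction i with
  | zero => simp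
  | succ i ih =>
    have hper : F (n + i) = F (0 + i) := by
      rw [zero_add, add_comm]
      exact hF i
    have h2 := sum_range_succ_shift (F := fun k => F (k + i)) (n := n) hper
    beta_reduce at h2
    rw [← ih, ← h2]
    exact Finset.sum_congr rfl fun m _ => by rw [show m + (i + 1) = m + 1 + i from by omega]

/-- **Rotation invariance**: rotating a closed walk does not change its crossing parity.
builds on p205010 (kernel theorem, internal audit signed; external expert review pending). [folklore] -/
theorem cpar_shift {n : ℕ} {y : ℕ → Site 2} (h : CycWalk n y) (i : ℕ) :
    cpar n (fun m => y (m + i)) = cpar n y := by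
  have hF : ∀ m, cf (y (m + n)) (y (m + n + 1)) = cf (y m) (y (m + 1)) := fun m => by
    rw [h.per, Nat.add_right_comm m n 1, h.per]
  have key := sum_range_shift_periodic (F := fun k => cf (y k) (y (k + 1))) hF i
  beta_reduce at key
  unfold cpar
  rw [← key]
  refine Finset.sum_congr rfl fun m _ => ?_
  show cf (y (m + i)) (y (m + 1 + i)) = cf (y (m + i)) (y (m + i + 1))
  rw [Nat.add_right_comm m 1 i]

/-! ## Splitting at a repeated point -/

/-- Successor modulo `j`: either no wrap-around or wrap-around.
builds on p205010 (kernel theorem, internal audit signed; external expert review pending). [folklore] -/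
theorem mod_succ_cases {j : ℕ} (hj : 0 < j) (m : ℕ) :
    ((m + 1) % j = m % j + 1 ∧ m % j + 1 < j) ∨ ((m + 1) % j = 0 ∧ m % j + 1 = j) := by
  have hlt := Nat.mod_lt m hj
  by_cases hc : m % j + 1 < j
  · left
    refine ⟨?_, hc⟩
    have h1 : 1 % j = 1 := Nat.mod_eq_of_lt (by omega)
    rw [Nat.add_mod, h1, Nat.mod_eq_of_lt hc]
  · right
    have heq : m % j + 1 = j := by omega
    refine ⟨?_, heq⟩
    by_cases hj1 : j = 1
    · subst hj1; simp [Nat.mod_one]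
    · have h1 : 1 % j = 1 := Nat.mod_eq_of_lt (by omega)
      rw [Nat.add_mod, h1, heq, Nat.mod_self]

/-- The first piece of a closed walk split at a return to its starting point is a closed walk.
builds on p205010 (kernel theorem, internal audit signed; external expert review pending). [folklore] -/
theorem CycWalk.splitA {n : ℕ} {y : ℕ → Site 2} (h : CycWalk n y) {j : ℕ} (hj : 0 < j) (hy : y j = y 0) :
    CycWalk j (fun m => y (m % j)) := by
  refine ⟨hj, fun m => by simp, fun m => ?_⟩
  show supDist (y (m % j)) (y ((m + 1) % j)) ≤ 1
  rcases mod_succ_cases hj m with ⟨h1, -⟩ | ⟨h1, h2⟩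
  · rw [h1]; exact h.step _
  · have h3 : y ((m + 1) % j) = y (m % j + 1) := by rw [h1, h2, hy]
    rw [h3]; exact h.step _

/-- The second piece of a closed walk split at a return to its starting point is a closed walk.
builds on p205010 (kernel theorem, internal audit signed; external expert review pending). [folklore] -/
theorem CycWalk.splitB {n : ℕ} {y : ℕ → Site 2} (h : CycWalk n y) {j : ℕ} (hjn : j < n) (hy : y j = y 0) :
    CycWalk (n - j) (fun m => y (j + m % (n - j))) := by
  refine ⟨by omega, fun m => by simp, fun m => ?_⟩
  show supDist (y (j + m % (n - j))) (y (j + (m + 1) % (n - j))) ≤ 1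
  rcases mod_succ_cases (show 0 < n - j by omega) m with ⟨h1, -⟩ | ⟨h1, h2⟩
  · rw [h1, ← add_assoc]; exact h.step _
  · have h3 : y (j + (m + 1) % (n - j)) = y (j + m % (n - j) + 1) := by
      rw [h1, add_zero, hy, ← h.apply_period, show j + m % (n - j) + 1 = n by omega]
    rw [h3]; exact h.step _

/-- **Additivity**: the crossing parity of a closed walk is the sum of the parities of its two pieces.
builds on p205010 (kernel theorem, internal audit signed; external expert review pending). [folklore] -/
theorem cpar_split {n : ℕ} {y : ℕ → Site 2} (h : CycWalk n y) {j : ℕ} (hj : 0 < j) (hjn : j < n) (hy : y j = y 0) :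
    cpar n y = cpar j (fun m => y (m % j)) + cpar (n - j) (fun m => y (j + m % (n - j))) := by
  unfold cpar
  conv_lhs => rw [show n = j + (n - j) by omega, Finset.sum_range_add]
  congr 1
  · refine Finset.sum_congr rfl fun m hm => ?_
    rw [Finset.mem_range] at hm
    show cf (y m) (y (m + 1)) = cf (y (m % j)) (y ((m + 1) % j))
    rw [Nat.mod_eq_of_lt hm]
    rcases mod_succ_cases hj m with ⟨h1, -⟩ | ⟨h1, h2⟩
    · rw [h1, Nat.mod_eq_of_lt hm]
    · rw [Nat.mod_eq_of_lt hm] at h2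
      rw [h1, ← hy, ← h2]
  · refine Finset.sum_congr rfl fun m hm => ?_
    rw [Finset.mem_range] at hm
    show cf (y (j + m)) (y (j + m + 1)) = cf (y (j + m % (n - j))) (y (j + (m + 1) % (n - j)))
    rw [Nat.mod_eq_of_lt hm]
    rcases mod_succ_cases (show 0 < n - j by omega) m with ⟨h1, -⟩ | ⟨h1, h2⟩
    · rw [h1, Nat.mod_eq_of_lt hm, ← add_assoc]
    · rw [Nat.mod_eq_of_lt hm] at h2
      rw [h1, add_zero, hy, ← h.apply_period, show n = j + m + 1 by omega]

/-- In `ZMod 2`, a sum equal to `1` has a summand equal to `1`.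
builds on p205010 (kernel theorem, internal audit signed; external expert review pending). [folklore] -/
theorem zmod2_eq_one_or_eq_one_of_add {a b : ZMod 2} (h : a + b = 1) : a = 1 ∨ b = 1 := by
  revert a b; decide

/-- **Extraction of a self-avoiding closed walk of odd parity.**  A closed `★`-walk of odd crossing parity whose points all satisfy `Q`
contains (is rotated and split down to) a closed `★`-walk of odd crossing parity, injective on a period, whose points all satisfy `Q`.
builds on p205010 (kernel theorem, internal audit signed; external expert review pending). [folklore] -/
theorem exists_injOn_cycWalk (Q : Site 2 → Prop) :
    ∀ (n : ℕ) (y : ℕ → Site 2), CycWalk n y → cpar n y = 1 → (∀ m, Q (y m)) →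
      ∃ (n' : ℕ) (y' : ℕ → Site 2), CycWalk n' y' ∧ cpar n' y' = 1 ∧ (∀ m, Q (y' m)) ∧ Set.InjOn y' (Set.Iio n') := by
  intro n
  induction n using Nat.strong_induction_on with
  | _ n ih =>
    intro y hy hpar hQ
    by_cases hinj : Set.InjOn y (Set.Iio n)
    · exact ⟨n, y, hy, hpar, hQ, hinj⟩
    · -- a repeated point `y i = y l`, `i < l < n`
      have key : ∀ i l, i < l → l < n → y i = y l →
          ∃ (n' : ℕ) (y' : ℕ → Site 2), CycWalk n' y' ∧ cpar n' y' = 1 ∧ (∀ m, Q (y' m)) ∧ Set.InjOn y' (Set.Iio n') := by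
        intro i l hil hln hyl
        set z : ℕ → Site 2 := fun m => y (m + i) with hz
        have hzw : CycWalk n z := hy.shift i
        have hzpar : cpar n z = 1 := by rw [hz, cpar_shift hy i]; exact hpar
        set j := l - i with hj
        have hj0 : 0 < j := by omega
        have hjn : j < n := by omega
        have hzj : z j = z 0 := by simp only [hz, zero_add, hj, Nat.sub_add_cancel hil.le, hyl]
        have hsplit := cpar_split hzw hj0 hjn hzj
        rw [hzpar] at hsplit
        rcases zmod2_eq_one_or_eq_one_of_add hsplit.symm with hA | hB
        · exact ih j hjn _ (hzw.splitA hj0 hzj) hA (fun m => hQ _)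
        · exact ih (n - j) (by omega) _ (hzw.splitB hjn hzj) hB (fun m => hQ _)
      rw [Set.InjOn] at hinj
      push Not at hinj
      obtain ⟨i, hi, l, hl, heq, hne⟩ := hinj
      rw [Set.mem_Iio] at hi hl
      rcases lt_or_gt_of_ne hne with hlt | hlt
      · exact key i l hlt hl heq
      · exact key l i hlt hi heq.symm

/-! ## The anchor: odd parity forces points on both half-axes -/

/-- Over a period of a closed `★`-walk, the row steps between rows `0` and `1` have even number (telescoping).
builds on p205010 (kernel theorem, internal audit signed; external expert review pending). [folklore] -/
theorem CycWalk.sum_rs_eq_zero {n : ℕ} {y : ℕ → Site 2} (h : CycWalk n y) :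
    ∑ m ∈ Finset.range n, rs (y m) (y (m + 1)) = 0 := by
  rw [Finset.sum_congr rfl fun m _ => rs_eq_uh_add_uh (h.step m),
    sum_range_telescope (fun m => uh (y m)) n]
  simp only [h.apply_period, zmod2_add_self]

/-- Hence the left crossing parity equals the right crossing parity.
builds on p205010 (kernel theorem, internal audit signed; external expert review pending). [folklore] -/
theorem CycWalk.sum_cf'_eq_cpar {n : ℕ} {y : ℕ → Site 2} (h : CycWalk n y) :
    ∑ m ∈ Finset.range n, cf' (y m) (y (m + 1)) = cpar n y := by
  have h0 := h.sum_rs_eq_zero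
  simp only [rs_eq_cf_add_cf', Finset.sum_add_distrib] at h0
  unfold cpar
  have : ∀ a b : ZMod 2, a + b = 0 → b = a := by decide
  exact this _ _ h0

/-- **Right anchor.**  A closed `★`-walk of odd crossing parity passes through a point `(a, 0)` with `a ≥ 1`.
builds on p205010 (kernel theorem, internal audit signed; external expert review pending). [folklore] -/
theorem exists_posAxis {n : ℕ} {y : ℕ → Site 2} (h : CycWalk n y) (hpar : cpar n y = 1) :
    ∃ m < n, y m 1 = 0 ∧ 1 ≤ y m 0 := by
  classical
  obtain ⟨m, hm, hne⟩ := Finset.exists_ne_zero_of_sum_ne_zero (by rw [cpar] at hpar; rw [hpar]; exact one_ne_zero)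
  rw [Finset.mem_range] at hm
  unfold cf at hne
  split_ifs at hne with hc
  · rcases hc with ⟨h1, h2, -⟩ | ⟨h1, h2, -⟩
    · exact ⟨m, hm, h1, h2⟩
    · by_cases hmn : m + 1 < n
      · exact ⟨m + 1, hmn, h1, h2⟩
      · have : m + 1 = n := by omega
        rw [this, h.apply_period] at h1 h2
        exact ⟨0, h.pos, h1, h2⟩
  · exact absurd rfl hne

/-- **Left anchor.**  A closed `★`-walk of odd crossing parity avoiding the origin passes through a point `(a', 0)` with `a' ≤ -1`.
builds on p205010 (kernel theorem, internal audit signed; external expert review pending). [folklore] -/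
theorem exists_negAxis {n : ℕ} {y : ℕ → Site 2} (h : CycWalk n y) (hpar : cpar n y = 1) (h0 : ∀ m, y m ≠ 0) :
    ∃ m < n, y m 1 = 0 ∧ y m 0 ≤ -1 := by
  classical
  have hsum : ∑ m ∈ Finset.range n, cf' (y m) (y (m + 1)) ≠ 0 := by
    rw [h.sum_cf'_eq_cpar, hpar]; exact one_ne_zero
  obtain ⟨m, hm, hne⟩ := Finset.exists_ne_zero_of_sum_ne_zero hsum
  rw [Finset.mem_range] at hm
  have hnz : ∀ k, y k 1 = 0 → y k 0 ≤ 0 → y k 0 ≤ -1 := by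
    intro k hk1 hk0
    by_contra hlt
    have hk00 : y k 0 = 0 := by omega
    exact h0 k (site_ext (by simpa using hk00) (by simpa using hk1))
  unfold cf' at hne
  split_ifs at hne with hc
  · rcases hc with ⟨h1, h2, -⟩ | ⟨h1, h2, -⟩
    · exact ⟨m, hm, h1, hnz m h1 h2⟩
    · by_cases hmn : m + 1 < n
      · exact ⟨m + 1, hmn, h1, hnz _ h1 h2⟩
      · have : m + 1 = n := by omega
        rw [this, h.apply_period] at h1 h2
        exact ⟨0, h.pos, h1, hnz 0 h1 h2⟩
  · exact absurd rfl hne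

/-- **The anchored point.**  A closed `★`-walk of period `n` with odd crossing parity avoiding the origin passes, at some index `m < n`,
through a point `(a, 0)` of the positive axis with `1 ≤ a ≤ n - 2` (so `a < n`).
builds on p205010 (kernel theorem, internal audit signed; external expert review pending). [folklore] -/
theorem exists_anchor {n : ℕ} {y : ℕ → Site 2} (h : CycWalk n y) (hpar : cpar n y = 1) (h0 : ∀ m, y m ≠ 0) :
    ∃ m < n, ∃ a : ℕ, 1 ≤ a ∧ a < n ∧ y m = Pi.single (0 : Fin 2) (a : ℤ) := by
  obtain ⟨m₁, hm₁, h11, h10⟩ := exists_posAxis h hpar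
  obtain ⟨m₂, hm₂, h21, h20⟩ := exists_negAxis h hpar h0
  have hdist : y m₁ 0 - y m₂ 0 ≤ (n : ℤ) - 1 := by
    rcases le_total m₁ m₂ with hle | hle
    · have := h.abs_sub_le hle
      have := (neg_le_abs _).trans this
      omega
    · have := h.abs_sub_le hle
      have := (le_abs_self _).trans this
      omega
  refine ⟨m₁, hm₁, (y m₁ 0).toNat, by omega, by omega, site_ext ?_ ?_⟩
  · simp; omega
  · simp [h11]

end Summit.CriticalPhenomena.PercolationContinuityZ3.Theorems.Quant.StarContour

end
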